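/-
Copyright: cell `pub-ymgap` (HUMAN RULING D-0062), Track A of `YM-PLAN.md`, DAG node N20 (= NE7b); R134 seat `pub-ymgap-dag-n20-d`
(strategy s3 «alternative currency», generation 7), module 13.  Released under the licence of the surrounding project.
-/
import Summits.QuantumFields.YangMills.Theorems.BalabanUVNodesN20ByValueMultiscaleTilt
import Summits.QuantumFields.YangMills.Theorems.BalabanUVNodesN20LCSAvgExpMoment
import HarnessLib

/-!
# YM-DAG node N20 (= NE7b), strategy s3, THE FOURTH CURRENCY «BY VALUE» (module 13): THE MULTISCALE PRODUCT LAW WITHOUT THE ROOT —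
# large-field events of Bałaban's iterated block averages `Ū^k` at ALL levels `k ≤ K` AT ONCE are jointly exponentially sparse under the
# level-0 lattice Yang–Mills state, with ONE Peierls factor per pinned plaquette of EVERY level:
# `μ_β(⋂_{k≤K}{∀ p ∈ Y_k, ε_k ≤ 1 − reTr Ū^k(∂p)}) ≤ Π_{k≤K} (e^{v_k}·e^{−τ_k β ε_k})^{#Y_k}` — NO root, NO dependence on the number of pinned
# levels; `τ_k > 0`, `v_k ≥ 0` depend on `N`, `L` and the LEVEL only (letter-based, geometric in `k`)

Track A of `YM-PLAN.md` (cell `pub-ymgap`, HUMAN RULING D-0062), node **N20** = spine estimate NE7b (`T4WeightBudget.RelWeightBound` — the cell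
`pub-balaban`'s OWN estimate, NOT PRINTED in [Bałaban 1983–89], NOT PROVED).  Seat `pub-ymgap-dag-n20-d` (R134, s3), generation 7, module 13 (module 12:
`…Theorems.BalabanUVNodesN20ByValueMultiscaleTilt`, the joint multiscale exponential plaquette moment).  Kernel theorems only: 0 `def`, 0 `sorry`, standard
axioms; COUNT-NEUTRAL (`--supports` K3⁗ `SpineGivenEndpointR13Sep`, stmt-QuantumFields-20292, `--as helper`).  Restate-immune.

THE POINT.  Markov's inequality applied ONCE to module 12's joint moment `jointExpMoment_levels` gives the multiscale Peierls bound for ALL levels at once;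
the canonical telescoping tilts `τ_k = G^{−k}∕(12(k+1)(k+2))` meet the budget `Σ_{k≤K} G^k τ_k ≤ 1∕12` for EVERY `K` (`Σ_{k<n} 1∕((k+1)(k+2)) = n∕(n+1)`),
so the rates do not depend on how many levels are pinned — module 11 §2's `1∕#J`-th root (equivalently: tilt `δ_j∕#J`) is gone:
* §0 (generic) `measureReal_le_integral_exp_mul_exp_neg` (Markov in exponential form), `sum_range_inv_succ_mul_succ` (the telescoping weights).
* §1 ★★★ **`gibbsMeasure_multiLevel_largeField_le`** (MASTER FORM, any tilts `t ≥ 0` in budget, any thresholds `ε_k`):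
  `μ_β{U | ∀ k ≤ K, ∀ p ∈ Y_k, ε_k ≤ 1 − reTr Ū^k(∂p)} ≤ exp(C·(Σ_k G^k t_k)·(Σ_k V^k #Y_k))·exp(−β·Σ_{k≤K} t_k ε_k #Y_k)`.
* §2 ★★★ **`gibbsMeasure_multiLevel_largeField_le_prod`** (PRODUCT FORM, canonical tilts): rates `τ_k > 0`, volume letters `v_k ≥ 0` (functions of `N`, `L`,
  `k` only) with `μ_β{U | ∀ k ≤ K, ∀ p ∈ Y_k, ε_k ≤ 1 − reTr Ū^k(∂p)} ≤ Π_{k≤K}(e^{v_k}·e^{−τ_k β ε_k})^{#Y_k}` for every `d = 4` parameter set (`P.L = L`),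
  every `K ≤ m + K_P`, every `β ≥ 4N`, all thresholds and every level-indexed family — ONE factor per pinned plaquette of EVERY level.
* §3 ★★ **`gibbsMeasure_multiLevel_largeField_dist1_le_prod`** — the same in the SIZE currency of [Balaban1987RG1]'s small-field conditions
  (`ε_k ≤ |Ū^k(∂p) − 1|`, `ε_k ≥ 0`; rate `τ_k β ε_k²∕(2N)` by `cmp′`).  Module 14 counts cells (one witness per pinned cube of every level) and reads the
  result on n20-c's label tower of record.
COMPARISON (honest).  Module 7 ∕ 8 (one level `k`): factor `e^{C_k δ_k}·e^{−δ_k β ε}` per plaquette with `δ_k = (A·M)^{−k}∕12`, `C_k δ_k = C·M^k∕12`; here, for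
all levels jointly, `τ_k = δ_k∕((k+1)(k+2))` and `v_k = C·M^k∕12` — the same volume letter, the rate divided by the telescoping weight `(k+1)(k+2)` instead of
by the number of pinned levels (module 11) or by `2` per extra level (module 8's Cauchy–Schwarz).  Any summable weight sequence would do.
WHAT THIS SHOWS (honest).  The product STRUCTURE of (MSP) (module 11 §3) is elementary by value; the located wall of NE7b in the fourth currency is EXACTLY
the LEVEL-UNIFORMITY of `τ_k`, `v_k` — constants depending on the running coupling only: Bałaban's inductive small-field analysis, print's KIND
[Balaban1989LargeFieldII] (1.79) p. 383, NOT print's statement, NOT in the tree.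

HONEST FRAMING.  Count-neutral kernel theorems with LETTER-BASED, LEVEL-DEPENDENT constants (`τ_k ~ (A·M)^{−k}`, `v_k ~ M^k`); nothing is uniform along a
renewal chain.  Nothing of Bałaban's is asserted; NE7b NOT PRINTED ∕ NOT PROVED; the (α)-instance 0∕1; N20 NOT discharged (typed 28∕28, discharged count
untouched); one finite four-torus programme at fixed `ε` — NOT ℝ⁴, NOT infinite volume, NOT OS, NOT a mass gap, NOT Clay.  References (LOCATORS only; no
decl carries a cite tag): T. Bałaban, CMP **109** (1987) 249–301 [Balaban1987RG1] ((0.4), (0.11) p. 253); CMP **99** (1985) 75–102 [Balaban1985RegularSpaces]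
((1.10) p. 77); CMP **122** (1989) 175–202 [Balaban1989LargeFieldI] ((0.1) p. 175); CMP **122** (1989) 355–392 [Balaban1989LargeFieldII] ((1.79)–(1.89)
pp. 383–387).
-/

set_option autoImplicit false

noncomputable section

open scoped BigOperators Matrix.Norms.L2Operator
open MeasureTheory
open Literature.MathematicalPhysics.QuantumFieldTheory.Balaban1983to89
open T4Continuum T4ReflectionCone BlockAveraging ExpMeanLog
open Summit.QuantumFields.YangMills.BalabanUVNodes.N20LCSAvgExpMoment (sq_div_le_one_sub_reTr_of_le_dist1)
open Summit.QuantumFields.YangMills.BalabanUVNodes.N20ByValueMultiscaleTilt (jointExpMoment_levels integrable_exp_levelsTilt)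

namespace Summit.QuantumFields.YangMills.BalabanUVNodes.N20ByValueMultiscalePeierls

/-! ## §0 Two generic devices: Markov in exponential form, and the telescoping weights -/

section Generic

variable {Ω : Type*} [MeasurableSpace Ω] {μ : Measure Ω} [IsFiniteMeasure μ]

/-- **MARKOV IN EXPONENTIAL FORM**: if `c ≤ g` on `S` and `exp ∘ g` is integrable, `μ(S) ≤ (∫ exp(g) dμ)·exp(−c)`. [folklore] -/
theorem measureReal_le_integral_exp_mul_exp_neg (S : Set Ω) (g : Ω → ℝ) (c : ℝ) (hS : ∀ ω ∈ S, c ≤ g ω)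
    (hint : Integrable (fun ω => Real.exp (g ω)) μ) :
    μ.real S ≤ (∫ ω, Real.exp (g ω) ∂μ) * Real.exp (-c) := by
  have hsub : S ⊆ {ω | Real.exp c ≤ Real.exp (g ω)} := fun ω hω => Real.exp_le_exp.2 (hS ω hω)
  have hmarkov := mul_meas_ge_le_integral_of_nonneg (μ := μ) (ae_of_all _ fun ω => (Real.exp_pos (g ω)).le) hint (Real.exp c)
  have h1 : μ.real S ≤ μ.real {ω | Real.exp c ≤ Real.exp (g ω)} := measureReal_mono hsub (measure_ne_top μ _)
  have h2 : μ.real {ω | Real.exp c ≤ Real.exp (g ω)} ≤ (∫ ω, Real.exp (g ω) ∂μ) / Real.exp c := by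
    rw [le_div_iff₀ (Real.exp_pos c), mul_comm]
    exact hmarkov
  calc μ.real S ≤ (∫ ω, Real.exp (g ω) ∂μ) / Real.exp c := h1.trans h2
    _ = (∫ ω, Real.exp (g ω) ∂μ) * Real.exp (-c) := by rw [Real.exp_neg, div_eq_mul_inv]

/-- The telescoping weights: `Σ_{k<n} 1∕((k+1)(k+2)) = n∕(n+1)` (`≤ 1`). [folklore] -/
theorem sum_range_inv_succ_mul_succ (n : ℕ) :
    ∑ k ∈ Finset.range n, (1 : ℝ) / (((k : ℝ) + 1) * ((k : ℝ) + 2)) = (n : ℝ) / ((n : ℝ) + 1) := by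
  induction n with
  | zero => simp
  | succ n ih =>
      rw [Finset.sum_range_succ, ih]
      have h1 : (n : ℝ) + 1 ≠ 0 := by positivity
      have h2 : (n : ℝ) + 2 ≠ 0 := by positivity
      have h3 : ((n + 1 : ℕ) : ℝ) + 1 ≠ 0 := by positivity
      push_cast
      field_simp
      ring

end Generic

/-! ## §1–§2 Multiscale Peierls: all levels at once, one factor per pinned plaquette of every level (master and product forms) -/

section Peierls

/-- ★★★ **MULTISCALE LARGE-FIELD SPARSENESS, MASTER FORM** (any tilts in budget): with the `G`, `V`, `C` of `jointExpMoment_levels`, for every `d = 4`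
parameter set `P` (`P.L = L`), `K ≤ m + K_P`, `β ≥ 4N`, family `Y`, tilt `t ≥ 0` with `Σ_{k≤K} G^k t_k ≤ 1∕12` and thresholds `ε_k`,
  `μ_β{U | ∀ k ≤ K, ∀ p ∈ Y_k, ε_k ≤ 1 − reTr Ū^k(∂p)} ≤ exp(C·(Σ_k G^k t_k)·(Σ_k V^k #Y_k))·exp(−β·Σ_{k≤K} t_k ε_k #Y_k)`
(Markov once on the joint moment). [folklore] -/
theorem gibbsMeasure_multiLevel_largeField_le (N : ℕ) [NeZero N] (L : ℕ) :
    ∃ G : ℝ, 0 < G ∧ ∃ V : ℝ, 1 ≤ V ∧ ∃ C : ℝ, 0 ≤ C ∧ ∀ (P : Params), P.d = 4 → P.L = L → ∀ (K : ℕ), K ≤ P.m + P.K →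
      ∀ (β : ℝ), 4 * N ≤ β → ∀ (Y : (k : ℕ) → Finset (Plaq P k)) (t : ℕ → ℝ), (∀ k, 0 ≤ t k) →
        ∑ k ∈ Finset.range (K + 1), G ^ k * t k ≤ 1 / 12 → ∀ (ε : ℕ → ℝ),
        (T4GenFunBounds.gibbsMeasure P β : Measure (GaugeField P 0 (Matrix.specialUnitaryGroup (Fin N) ℂ))).real
            {U | ∀ k ∈ Finset.range (K + 1), ∀ p ∈ Y k, ε k ≤ 1 - reTr (GaugeField.plaqHol
              (Averaging.iter (fun _ => blockAvg (expMeanLogSU (n := Fin N))) k U) p)} ≤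
          Real.exp (C * (∑ k ∈ Finset.range (K + 1), G ^ k * t k) * ∑ k ∈ Finset.range (K + 1), V ^ k * (Y k).card) *
            Real.exp (-(β * ∑ k ∈ Finset.range (K + 1), t k * ε k * (Y k).card)) := by
  obtain ⟨G, hG, V, hV, C, hC, h⟩ := jointExpMoment_levels N L
  refine ⟨G, hG, V, hV, C, hC, fun P hd hL K hK β hβ Y t ht hbudget ε => ?_⟩
  have hNpos : (0 : ℝ) < N := Nat.cast_pos.mpr (Nat.pos_of_ne_zero (NeZero.ne N))
  have hβ0 : 0 ≤ β := le_trans (by positivity) hβ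
  haveI := T4GenFunBounds.isProbabilityMeasure_gibbsMeasure (G := Matrix.specialUnitaryGroup (Fin N) ℂ) P hβ0
  have hmom := h P hd hL K hK β hβ Y t ht hbudget
  have hmarkov := measureReal_le_integral_exp_mul_exp_neg
    (μ := (T4GenFunBounds.gibbsMeasure P β : Measure (GaugeField P 0 (Matrix.specialUnitaryGroup (Fin N) ℂ))))
    {U | ∀ k ∈ Finset.range (K + 1), ∀ p ∈ Y k, ε k ≤ 1 - reTr (GaugeField.plaqHol
      (Averaging.iter (fun _ => blockAvg (expMeanLogSU (n := Fin N))) k U) p)}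
    (fun U => β * ∑ k ∈ Finset.range (K + 1), t k * ∑ p ∈ Y k, (1 - reTr (GaugeField.plaqHol
      (Averaging.iter (fun _ => blockAvg (expMeanLogSU (n := Fin N))) k U) p)))
    (β * ∑ k ∈ Finset.range (K + 1), t k * ε k * (Y k).card) (fun U hU => ?_) (integrable_exp_levelsTilt P hβ0 K Y ht)
  · exact hmarkov.trans (mul_le_mul_of_nonneg_right hmom (Real.exp_pos _).le)
  · -- on the event, every pinned plaquette of level `k` contributes at least `t_k ε_k`
    refine mul_le_mul_of_nonneg_left (Finset.sum_le_sum fun k hk => ?_) hβ0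
    rw [mul_assoc]
    refine mul_le_mul_of_nonneg_left ?_ (ht k)
    calc ε k * (Y k).card = ∑ _p ∈ Y k, ε k := by rw [Finset.sum_const, nsmul_eq_mul, mul_comm]
      _ ≤ ∑ p ∈ Y k, (1 - reTr (GaugeField.plaqHol
            (Averaging.iter (fun _ => blockAvg (expMeanLogSU (n := Fin N))) k U) p)) :=
          Finset.sum_le_sum fun p hp => hU k hk p hp

/-- ★★★ **MULTISCALE LARGE-FIELD SPARSENESS, PRODUCT FORM** (canonical tilts).  For every `N ≥ 1` and `L` there are rates `τ_k > 0` and volume letters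
`v_k ≥ 0` (functions of `N`, `L`, `k` only: `τ_k = G^{−k}∕(12(k+1)(k+2))`, `v_k = C·V^k∕12`) such that for every `d = 4` parameter set `P`
(`P.L = L`), every `K ≤ m + K_P`, every `β ≥ 4N`, all thresholds `ε_k` and every level-indexed family `Y_k ⊆ Plaq P k`,
  `μ_β{U | ∀ k ≤ K, ∀ p ∈ Y_k, ε_k ≤ 1 − reTr Ū^k(∂p)} ≤ Π_{k≤K} (e^{v_k}·e^{−τ_k β ε_k})^{#Y_k}`
— ONE Peierls factor per pinned plaquette of EVERY level, NO root, NO dependence on the number of pinned levels (the budget is met by the telescoping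
weights `Σ_{k≤K} 1∕((k+1)(k+2)) < 1`). [folklore] -/
theorem gibbsMeasure_multiLevel_largeField_le_prod (N : ℕ) [NeZero N] (L : ℕ) :
    ∃ τ : ℕ → ℝ, (∀ k, 0 < τ k) ∧ ∃ v : ℕ → ℝ, (∀ k, 0 ≤ v k) ∧ ∀ (P : Params), P.d = 4 → P.L = L → ∀ (K : ℕ), K ≤ P.m + P.K →
      ∀ (β : ℝ), 4 * N ≤ β → ∀ (ε : ℕ → ℝ) (Y : (k : ℕ) → Finset (Plaq P k)),
        (T4GenFunBounds.gibbsMeasure P β : Measure (GaugeField P 0 (Matrix.specialUnitaryGroup (Fin N) ℂ))).real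
            {U | ∀ k ∈ Finset.range (K + 1), ∀ p ∈ Y k, ε k ≤ 1 - reTr (GaugeField.plaqHol
              (Averaging.iter (fun _ => blockAvg (expMeanLogSU (n := Fin N))) k U) p)} ≤
          ∏ k ∈ Finset.range (K + 1), (Real.exp (v k) * Real.exp (-(τ k * β * ε k))) ^ (Y k).card := by
  obtain ⟨G, hG, V, hV, C, hC, h⟩ := gibbsMeasure_multiLevel_largeField_le N L
  set τ : ℕ → ℝ := fun k => (G ^ k)⁻¹ * (1 / (12 * (((k : ℝ) + 1) * ((k : ℝ) + 2)))) with hτ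
  set v : ℕ → ℝ := fun k => C / 12 * V ^ k with hv
  have hV0 : 0 ≤ V := le_trans zero_le_one hV
  have hτ0 : ∀ k, 0 < τ k := fun k => by rw [hτ]; positivity
  have hv0 : ∀ k, 0 ≤ v k := fun k => by rw [hv]; positivity
  refine ⟨τ, hτ0, v, hv0, fun P hd hL K hK β hβ ε Y => ?_⟩
  -- the budget
  have hbudget : ∑ k ∈ Finset.range (K + 1), G ^ k * τ k ≤ 1 / 12 := by
    have hGk : ∀ k, G ^ k * τ k = (1 / 12) * (1 / (((k : ℝ) + 1) * ((k : ℝ) + 2))) := by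
      intro k
      rw [hτ]
      have hGne : G ^ k ≠ 0 := pow_ne_zero _ hG.ne'
      field_simp
    simp_rw [hGk, ← Finset.mul_sum, sum_range_inv_succ_mul_succ]
    have h1 : ((K + 1 : ℕ) : ℝ) / (((K + 1 : ℕ) : ℝ) + 1) ≤ 1 := by
      rw [div_le_one (by positivity)]; linarith
    calc (1 / 12 : ℝ) * (((K + 1 : ℕ) : ℝ) / (((K + 1 : ℕ) : ℝ) + 1)) ≤ 1 / 12 * 1 :=
          mul_le_mul_of_nonneg_left h1 (by norm_num)
      _ = 1 / 12 := mul_one _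
  have hmain := h P hd hL K hK β hβ Y τ (fun k => (hτ0 k).le) hbudget ε
  -- rewrite both exponentials as products of per-level powers
  have hsum0 : 0 ≤ ∑ k ∈ Finset.range (K + 1), V ^ k * ((Y k).card : ℝ) :=
    Finset.sum_nonneg fun k _ => mul_nonneg (pow_nonneg hV0 _) (Nat.cast_nonneg _)
  have h1 : Real.exp (C * (∑ k ∈ Finset.range (K + 1), G ^ k * τ k) * ∑ k ∈ Finset.range (K + 1), V ^ k * ((Y k).card : ℝ)) ≤
      Real.exp (∑ k ∈ Finset.range (K + 1), v k * (Y k).card) := by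
    refine Real.exp_le_exp.mpr ?_
    calc C * (∑ k ∈ Finset.range (K + 1), G ^ k * τ k) * ∑ k ∈ Finset.range (K + 1), V ^ k * ((Y k).card : ℝ)
        ≤ C * (1 / 12) * ∑ k ∈ Finset.range (K + 1), V ^ k * ((Y k).card : ℝ) :=
          mul_le_mul_of_nonneg_right (mul_le_mul_of_nonneg_left hbudget hC) hsum0
      _ = ∑ k ∈ Finset.range (K + 1), v k * (Y k).card := by
          rw [Finset.mul_sum]
          exact Finset.sum_congr rfl fun k _ => by rw [hv]; ring
  have h2 : Real.exp (∑ k ∈ Finset.range (K + 1), v k * (Y k).card) =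
      ∏ k ∈ Finset.range (K + 1), Real.exp (v k) ^ (Y k).card := by
    rw [Real.exp_sum]
    exact Finset.prod_congr rfl fun k _ => by rw [← Real.exp_nat_mul]; ring_nf
  have h3 : Real.exp (-(β * ∑ k ∈ Finset.range (K + 1), τ k * ε k * (Y k).card)) =
      ∏ k ∈ Finset.range (K + 1), Real.exp (-(τ k * β * ε k)) ^ (Y k).card := by
    rw [Finset.mul_sum, ← Finset.sum_neg_distrib, Real.exp_sum]
    exact Finset.prod_congr rfl fun k _ => by rw [← Real.exp_nat_mul]; ring_nf
  calc (T4GenFunBounds.gibbsMeasure P β : Measure (GaugeField P 0 (Matrix.specialUnitaryGroup (Fin N) ℂ))).real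
          {U | ∀ k ∈ Finset.range (K + 1), ∀ p ∈ Y k, ε k ≤ 1 - reTr (GaugeField.plaqHol
            (Averaging.iter (fun _ => blockAvg (expMeanLogSU (n := Fin N))) k U) p)}
      ≤ Real.exp (C * (∑ k ∈ Finset.range (K + 1), G ^ k * τ k) * ∑ k ∈ Finset.range (K + 1), V ^ k * ((Y k).card : ℝ)) *
          Real.exp (-(β * ∑ k ∈ Finset.range (K + 1), τ k * ε k * (Y k).card)) := hmain
    _ ≤ Real.exp (∑ k ∈ Finset.range (K + 1), v k * (Y k).card) *
          Real.exp (-(β * ∑ k ∈ Finset.range (K + 1), τ k * ε k * (Y k).card)) :=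
        mul_le_mul_of_nonneg_right h1 (Real.exp_pos _).le
    _ = ∏ k ∈ Finset.range (K + 1), (Real.exp (v k) * Real.exp (-(τ k * β * ε k))) ^ (Y k).card := by
        rw [h2, h3, ← Finset.prod_mul_distrib]
        exact Finset.prod_congr rfl fun k _ => by rw [mul_pow]

end Peierls

/-! ## §3 The same in the size currency -/

section Size

/-- ★★ **MULTISCALE LARGE-FIELD SPARSENESS IN THE SIZE CURRENCY** (`ε_k ≤ |Ū^k(∂p) − 1|`, the currency of [Balaban1987RG1]'s small-field conditions and of
the road's regularity letters): with the SAME `τ`, `v` as `gibbsMeasure_multiLevel_largeField_le_prod`, for non-negative thresholds `ε_k`,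
  `μ_β{U | ∀ k ≤ K, ∀ p ∈ Y_k, ε_k ≤ |Ū^k U(∂p) − 1|} ≤ Π_{k≤K} (e^{v_k}·e^{−τ_k β ε_k²∕(2N)})^{#Y_k}`
(`ε ≤ |g − 1| ⇒ ε²∕(2N) ≤ 1 − reTr g` on `SU(N)`, `cmp′`). [folklore] -/
theorem gibbsMeasure_multiLevel_largeField_dist1_le_prod (N : ℕ) [NeZero N] (L : ℕ) :
    ∃ τ : ℕ → ℝ, (∀ k, 0 < τ k) ∧ ∃ v : ℕ → ℝ, (∀ k, 0 ≤ v k) ∧ ∀ (P : Params), P.d = 4 → P.L = L → ∀ (K : ℕ), K ≤ P.m + P.K →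
      ∀ (β : ℝ), 4 * N ≤ β → ∀ (ε : ℕ → ℝ), (∀ k, 0 ≤ ε k) → ∀ (Y : (k : ℕ) → Finset (Plaq P k)),
        (T4GenFunBounds.gibbsMeasure P β : Measure (GaugeField P 0 (Matrix.specialUnitaryGroup (Fin N) ℂ))).real
            {U | ∀ k ∈ Finset.range (K + 1), ∀ p ∈ Y k, ε k ≤ dist1 (GaugeField.plaqHol
              (Averaging.iter (fun _ => blockAvg (expMeanLogSU (n := Fin N))) k U) p)} ≤
          ∏ k ∈ Finset.range (K + 1),
            (Real.exp (v k) * Real.exp (-(τ k * β * (ε k ^ 2 / (2 * (Fintype.card (Fin N) : ℝ)))))) ^ (Y k).card := by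
  obtain ⟨τ, hτ, v, hv, h⟩ := gibbsMeasure_multiLevel_largeField_le_prod N L
  refine ⟨τ, hτ, v, hv, fun P hd hL K hK β hβ ε hε Y => ?_⟩
  have hNpos : (0 : ℝ) < N := Nat.cast_pos.mpr (Nat.pos_of_ne_zero (NeZero.ne N))
  have hβ0 : 0 ≤ β := le_trans (by positivity) hβ
  haveI := T4GenFunBounds.isProbabilityMeasure_gibbsMeasure (G := Matrix.specialUnitaryGroup (Fin N) ℂ) P hβ0
  have hsub : {U : GaugeField P 0 (Matrix.specialUnitaryGroup (Fin N) ℂ) | ∀ k ∈ Finset.range (K + 1), ∀ p ∈ Y k,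
        ε k ≤ dist1 (GaugeField.plaqHol (Averaging.iter (fun _ => blockAvg (expMeanLogSU (n := Fin N))) k U) p)} ⊆
      {U | ∀ k ∈ Finset.range (K + 1), ∀ p ∈ Y k, ε k ^ 2 / (2 * (Fintype.card (Fin N) : ℝ)) ≤
        1 - reTr (GaugeField.plaqHol (Averaging.iter (fun _ => blockAvg (expMeanLogSU (n := Fin N))) k U) p)} :=
    fun U hU k hk p hp => sq_div_le_one_sub_reTr_of_le_dist1 _ (hε k) (hU k hk p hp)
  exact (measureReal_mono hsub (measure_ne_top _ _)).trans
    (h P hd hL K hK β hβ (fun k => ε k ^ 2 / (2 * (Fintype.card (Fin N) : ℝ))) Y)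

end Size

end Summit.QuantumFields.YangMills.BalabanUVNodes.N20ByValueMultiscalePeierls

end
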